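import Summits.CriticalPhenomena.PercolationContinuityZ3.Theorems.PercNecklaceBackboneNoBackboneBirthGlue
import Literature.Probability.Percolation.BondTwoArmsAKN
import Literature.Probability.Percolation.CriticalContinuityProofs
import HarnessLib

/-!
# Crux `NoBackbone` (stmt-CriticalPhenomena-5268), line `registered` — the two-cluster engine

Route `PercNecklaceBackbone`, crux
`Summit.CriticalPhenomena.PercolationContinuityZ3.Theses.PercNecklaceBackbone.NoBackbone`
(`Q(p_c) := P_{p_c(ℤ³)}{ω | ∀ e, ω ∖ {e} ∈ {|C(0)| = ∞}} = 0`).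

The registered line bounds the cut-form TWO-ROUTE function
`P_{p_c}(T_m)`, `T_m = {ω | ∀ e, ∃ y, ‖y‖∞ ≥ m ∧ 0 ↔ y in ω ∖ {e}}`, by a comparison with a
quantity that DECAYS at `p_c`.  The only quantity with a PROVED polynomial rate at `p_c(ℤ³)` in the
tree is the Aizenman–Kesten–Newman TWO-CLUSTER (edge two-arms) function
`P_p(AKN.edgeTwoArms i m) ≤ κ (1 + log m)/√m` (Cerf 2015, Prop. 5.2, bond version, uniformly in
`p ∈ [δ, 1 − δ]`: `Literature.Probability.Percolation.AKN.exists_real_edgeTwoArms_le`).  This file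
certifies the corresponding ONE-comparison engine (the route's foreseen `SameClusterBKPlus` transfer
"monochromatic two-route ⟹ two-cluster event", two-layer plan of `Theses/PercNecklaceBackbone.lean`):

* `exists_real_edgeTwoArms_criticalProb_le` : the AKN/Cerf bound AT `p_c(ℤ³)` (`0 < p_c < 1`).
* `rpow_mul_log_div_sqrt_le` : the exponent budget `m^κ (1 + log m)/√m ≤ (1 + 2/(1/2 − κ)) m^{-(1/2-κ)/2}`
  for `κ < 1/2`, `m ≥ 1` (the logarithm is absorbed).
* `noBackbone_of_twoClusterDomination` : **if `P_{p_c}(T_m) ≤ C m^κ P_{p_c}(edgeTwoArms i m)` for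
  some `κ < 1/2` and all `m ≥ 1`, then `NoBackbone`** — by the landed one-piece glue
  `noBackbone_of_twoRoute_decay`.

The comparison hypothesis is the whole open content of that engine; its numerical margin is recorded
on the crux item (Monte-Carlo evidence of the lead, cycle 2): the threshold is `κ ≥ x_A − x_T`, with
`x_T` the two-route exponent and `x_A` the two-cluster exponent at `p_c(ℤ³)`.

Sources: Aizenman–Kesten–Newman 1987; Cerf 2015 (arXiv:1306.3105) §5; Duminil-Copin–Kozma–Tassion
2020 §7 (38).
-/

noncomputable section

namespace Summit.CriticalPhenomena.PercolationContinuityZ3.Theorems.NoBackboneBirth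

open MeasureTheory Filter Literature.Probability.Percolation Literature.Probability.LatticeModels
open scoped Topology
open Summit.CriticalPhenomena.PercolationContinuityZ3.Theses.PercNecklaceBackbone (NoBackbone)

/-- **The AKN/Cerf two-cluster bound at `p_c(ℤ³)`**: there is `K > 0` with
`P_{p_c}(edgeTwoArms i m) ≤ K (1 + log m)/√m` for every direction `i` and every `m ≥ 1`
(`0 < p_c(ℤ³) < 1`, so `p_c ∈ [δ, 1 − δ]` for `δ = min (1/2) (min p_c (1 − p_c))`).
[cite: Cerf2015, Prop 5.2] -/
theorem exists_real_edgeTwoArms_criticalProb_le :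
    ∃ K : ℝ, 0 < K ∧ ∀ i : Fin 3, ∀ m : ℕ, 1 ≤ m →
      (bondPercolation (zdGraph 3) (criticalProbI 3)).real (AKN.edgeTwoArms i m) ≤
        K * (1 + Real.log m) / Real.sqrt m := by
  have hp0 : 0 < (criticalProbI 3 : ℝ) := by
    rw [coe_criticalProbI]; exact criticalProb_zd_pos 3 (by norm_num)
  have hp1 : (criticalProbI 3 : ℝ) < 1 := by
    rw [coe_criticalProbI]; exact criticalProb_zd_lt_one (by norm_num)
  set δ : ℝ := min (1 / 2) (min (criticalProbI 3 : ℝ) (1 - (criticalProbI 3 : ℝ))) with hδ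
  have hδ0 : 0 < δ := lt_min (by norm_num) (lt_min hp0 (by linarith))
  have hδ2 : δ ≤ 1 / 2 := min_le_left _ _
  obtain ⟨K, hK0, hK⟩ := AKN.exists_real_edgeTwoArms_le (d := 3) (by norm_num) hδ0 hδ2
  refine ⟨K, hK0, fun i m hm => hK (criticalProbI 3) ?_ ?_ i m hm⟩
  · exact (min_le_right _ _).trans (min_le_left _ _)
  · have : δ ≤ 1 - (criticalProbI 3 : ℝ) := (min_le_right _ _).trans (min_le_right _ _)
    linarith

/-- **Exponent budget with the logarithm absorbed**: for `κ < 1/2` and `m ≥ 1`,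
`m^κ · (1 + log m)/√m ≤ (1 + 2/(1/2 − κ)) · m^{-(1/2 − κ)/2}` (`log m ≤ m^ε/ε` with
`ε = (1/2 − κ)/2`). [folklore] -/
theorem rpow_mul_log_div_sqrt_le {κ : ℝ} (hκ : κ < 1 / 2) {m : ℝ} (hm : 1 ≤ m) :
    m ^ κ * ((1 + Real.log m) / Real.sqrt m) ≤
      (1 + 2 / (1 / 2 - κ)) * m ^ (-((1 / 2 - κ) / 2)) := by
  set ε : ℝ := (1 / 2 - κ) / 2 with hε
  have hε0 : 0 < ε := by rw [hε]; linarith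
  have hm0 : 0 < m := by linarith
  have hmε : 0 < m ^ ε := Real.rpow_pos_of_pos hm0 ε
  have h1 : (1 : ℝ) ≤ m ^ ε := Real.one_le_rpow hm hε0.le
  have hlog : Real.log m ≤ m ^ ε / ε := Real.log_le_rpow_div hm0.le hε0
  have h2 : 1 + Real.log m ≤ (1 + 1 / ε) * m ^ ε := by
    have : m ^ ε / ε = 1 / ε * m ^ ε := by ring
    rw [this] at hlog
    nlinarith
  have hcoef : 1 + 1 / ε = 1 + 2 / (1 / 2 - κ) := by
    rw [hε]; field_simp
  have hsqrt : Real.sqrt m = m ^ (1 / 2 : ℝ) := Real.sqrt_eq_rpow m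
  have hexp : m ^ κ * m ^ ε / m ^ (1 / 2 : ℝ) = m ^ (-((1 / 2 - κ) / 2)) := by
    rw [← Real.rpow_add hm0, ← Real.rpow_sub hm0]
    congr 1
    rw [hε]; ring
  have hhalf : 0 < m ^ (1 / 2 : ℝ) := Real.rpow_pos_of_pos hm0 _
  have hκ0 : 0 ≤ m ^ κ := Real.rpow_nonneg hm0.le κ
  calc m ^ κ * ((1 + Real.log m) / Real.sqrt m)
        = m ^ κ * (1 + Real.log m) / m ^ (1 / 2 : ℝ) := by rw [hsqrt]; ring
    _ ≤ m ^ κ * ((1 + 1 / ε) * m ^ ε) / m ^ (1 / 2 : ℝ) := by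
        gcongr
    _ = (1 + 1 / ε) * (m ^ κ * m ^ ε / m ^ (1 / 2 : ℝ)) := by ring
    _ = (1 + 2 / (1 / 2 - κ)) * m ^ (-((1 / 2 - κ) / 2)) := by rw [hexp, hcoef]

/-- **The two-cluster engine**: if the critical cut-form two-route function is dominated, up to a
polynomial loss `m^κ` with `κ < 1/2`, by the Aizenman–Kesten–Newman two-cluster (edge two-arms)
function — `P_{p_c}(T_m) ≤ C m^κ P_{p_c}(edgeTwoArms i m)` for all `m ≥ 1` — then `NoBackbone`:
the AKN/Cerf rate `(1 + log m)/√m` (`exists_real_edgeTwoArms_criticalProb_le`) beats the loss, so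
`P_{p_c}(T_m) ≤ C' m^{-(1/2-κ)/2}` and `noBackbone_of_twoRoute_decay` applies.
[cite: Cerf2015, Prop 5.2] -/
theorem noBackbone_of_twoClusterDomination :
    ∀ i : Fin 3, (∃ κ C : ℝ, κ < 1 / 2 ∧ ∀ m : ℕ, 1 ≤ m → (bondPercolation (zdGraph 3) (criticalProbI 3)).real {ω | ∀ e : Sym2 (Site 3), ∃ y : Site 3, (∃ j : Fin 3, (m : ℤ) ≤ |y j|) ∧ ω \ {e} ∈ openConn (0 : Site 3) y} ≤ C * (m : ℝ) ^ κ * (bondPercolation (zdGraph 3) (criticalProbI 3)).real (AKN.edgeTwoArms i m)) → Summit.CriticalPhenomena.PercolationContinuityZ3.Theses.PercNecklaceBackbone.NoBackbone := by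
  intro i
  rintro ⟨κ, C, hκ, hC⟩
  obtain ⟨K, hK0, hK⟩ := exists_real_edgeTwoArms_criticalProb_le
  refine noBackbone_of_twoRoute_decay
    ⟨(1 / 2 - κ) / 2, max C 0 * K * (1 + 2 / (1 / 2 - κ)), by linarith, fun m hm => ?_⟩
  have hm1 : (1 : ℝ) ≤ m := by exact_mod_cast hm
  have hm0 : (0 : ℝ) < m := by linarith
  have hmκ : 0 ≤ (m : ℝ) ^ κ := Real.rpow_nonneg hm0.le κ
  have hA : 0 ≤ (bondPercolation (zdGraph 3) (criticalProbI 3)).real (AKN.edgeTwoArms i m) :=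
    measureReal_nonneg
  calc (bondPercolation (zdGraph 3) (criticalProbI 3)).real
          {ω | ∀ e : Sym2 (Site 3), ∃ y : Site 3, (∃ j : Fin 3, (m : ℤ) ≤ |y j|) ∧
            ω \ {e} ∈ openConn (0 : Site 3) y}
        ≤ C * (m : ℝ) ^ κ *
          (bondPercolation (zdGraph 3) (criticalProbI 3)).real (AKN.edgeTwoArms i m) := hC m hm
    _ ≤ max C 0 * (m : ℝ) ^ κ *
          (bondPercolation (zdGraph 3) (criticalProbI 3)).real (AKN.edgeTwoArms i m) :=
        mul_le_mul_of_nonneg_right (mul_le_mul_of_nonneg_right (le_max_left _ _) hmκ) hA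
    _ ≤ max C 0 * (m : ℝ) ^ κ * (K * (1 + Real.log m) / Real.sqrt m) :=
        mul_le_mul_of_nonneg_left (hK i m hm) (mul_nonneg (le_max_right _ _) hmκ)
    _ = max C 0 * K * ((m : ℝ) ^ κ * ((1 + Real.log m) / Real.sqrt m)) := by ring
    _ ≤ max C 0 * K * ((1 + 2 / (1 / 2 - κ)) * (m : ℝ) ^ (-((1 / 2 - κ) / 2))) :=
        mul_le_mul_of_nonneg_left (rpow_mul_log_div_sqrt_le hκ hm1)
          (mul_nonneg (le_max_right _ _) hK0.le)
    _ = max C 0 * K * (1 + 2 / (1 / 2 - κ)) * (m : ℝ) ^ (-((1 / 2 - κ) / 2)) := by ring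

end Summit.CriticalPhenomena.PercolationContinuityZ3.Theorems.NoBackboneBirth

end
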